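import Literature.NumberTheory.Sieve.FriedlanderIwaniecPrimesSeparationDivisor
import HarnessLib

/-!
# Friedlander–Iwaniec, *The polynomial `X² + Y⁴` captures its primes*, §24: the description `(𝔡⁺)`, `(𝔡⁻)` of `m(ℓ)`, `n(ℓ)`, uniqueness of `ℓ = 𝔡 m n`, Lemma 24.1 and Proposition 24.2

Family `parity`, statement parity.S17 (`setOf_prime_sq_add_pow_four_infinite`). Source: J. Friedlander,
H. Iwaniec, Ann. of Math. (2) 148 (1998), 945–1040 [FriedlanderIwaniecAnnals1998], §24 "Combinatorial
identities for sums of arithmetic functions", (24.7)–(24.13), Lemma 24.1, Proposition 24.2 (arXiv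
math/9811185, pp. 81–83). Sequel of `FriedlanderIwaniecPrimesSeparationDivisor` ((24.1)–(24.8):
`primeIdx`, `sepDivisor = 𝔡`, `plusPart = m`, `minusPart = n`). Everything here is PROVED; the
definitions are `dRank`, `dBlock`, `IsPlusAdm` (`(𝔡⁺)`), `IsMinusAdm` (`(𝔡⁻)`), `smoothSqf`, `sqfLE`,
`roughCount` (`ν(ℓ, z)`), `primesIcc`; no named facts.

## The source (p. 82)

"Hence we obtain the factorization (24.7) `ℓ = 𝔡 m n` (we have the unique factorization of this
type) … It is clear that we can characterize the divisors `m` and `n` of `ℓ` solely in terms of the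
separation divisor `𝔡`. Indeed, writing `𝔡 = π₁ … π_r π_{r+1} … π_t`, we see that: `(𝔡⁺)` the first
largest `r - 1` prime divisors of `m` are in `(π_{r+1}, π_r)`, the second largest `r - 1` prime
divisors of `m` are in `(π_{r+3}, π_{r+2})`, and so on; `(𝔡⁻)` the first largest `r - 1` prime divisors
of `n` are in `(π_{r+2}, π_{r+1})`, the second largest `r - 1` prime divisors of `n` are in
`(π_{r+4}, π_{r+3})`, and so on. … LEMMA 24.1. Let `f(ℓ)` be an arithmetic function supported on
squarefree numbers `ℓ ≤ x`. Then `Σ_{ℓ∣P(z)} f(ℓ) = Σ_{𝔡≤D} ΣΣ_{m,n≤√x} γ⁺_𝔡(m) γ⁻_𝔡(n) f(𝔡mn)` … If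
`f(ℓ)` is not supported on numbers free of prime divisors `> z` then we have an additional sum
(24.12) … with `ν(ℓ, z)` the number of prime factors `p > z` of `ℓ` … PROPOSITION 24.2 (24.13)."

## How the description is made precise

For a prospective separation divisor `d` (prime factors `π₁ > π₂ > ⋯ > π_t`) and a prime `p ∤ d`,
`dRank d p = A_d(p) = #{π ∣ d : π > p}` and the *block* `dBlock r d p = A_d(p) + 1 - r = k` encode
"`p ∈ (π_{r+k}, π_{r+k-1})`" (`π_{t+1} := 1`). `IsPlusAdm r d m` (`(𝔡⁺)`): `m` squarefree, each prime
of `m` prime to `d`, of rank `≥ r`, in an odd block; each odd block `k` with `r + k ≤ t` (a block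
bounded below by a prime of `d`) contains exactly `r - 1` primes of `m`; the bottom block (rank `t`)
contains at most `r - 1` ("the product terminates when it runs out of primes"). `IsMinusAdm` is the
same with even blocks. With this reading the factorisation is a genuine bijection
(`sepTriple_eq_iff`). Two precisions with respect to the printed text: in (24.11) the right side must
carry `𝔡 m n ∣ P(z)` (equivalently `𝔡 ∣ P(z)`), since `f` is only assumed supported on squarefree
`ℓ ≤ x` — here the summand carries the indicator `𝔡 m n ∈ smoothSqf x z`; and with
`P(z) = ∏_{p<z} p` (24.9) the complementary primes in (24.12) are `p ≥ z` (immaterial for the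
non-integral `z = x^{1/r²}` of the source).

## Contents

* `card_Ico_filter_isSepIdx` (`#{i < j separation index} = r + ⌊(j-1)/r⌋ - 1` for `j > r`);
  `dRank`, `dRank_sepDivisor_eq` (the `𝔡(ℓ)`-rank of `p_j` is the number of separation indices
  `< j`), `dBlock`, `dBlock_sepDivisor_eq` (`= ⌊(j-1)/r⌋`), `card_primeFactors_sepDivisor(_of_le)`
  (`ω(𝔡) = r + ⌊ω(ℓ)/r⌋ - 1`), `card_filter_primeIdx_mem`.
* `IsPlusAdm`, `IsMinusAdm`; **`isPlusAdm_plusPart`, `isMinusAdm_minusPart`** (`m(ℓ)`, `n(ℓ)` satisfy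
  `(𝔡(ℓ)^±)`).
* Uniqueness: for `d` squarefree, `m ∈ (d⁺)`, `n ∈ (d⁻)` and `ℓ = d m n`: `squarefree_of_adm`,
  `primeIdx_of_adm` (the index splits over `d`, `m`, `n`), `card_block_eq` / `card_block_le` /
  `card_block_le_eq` (block and cumulative block counts of the free primes), `primeIdx_free_bounds`
  (a free prime of block `k` has index in `(kr, (k+1)r)`), `primeIdx_sep_eq` (`π_i ↦ i` for `i ≤ r`,
  `π_{r+k'} ↦ (k'+1) r`), hence **`sepDivisor_of_adm`, `plusPart_of_adm`, `minusPart_of_adm`**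
  (`𝔡(dmn) = d`, `m(dmn) = m`, `n(dmn) = n`) and the bijection **`sepTriple_eq_iff`** (24.7).
* **Lemma 24.1**: the reindexing core `sum_eq_sum_sepTriple` (any finite set of squarefree `ℓ`, any
  additive commutative monoid) and the printed form `sum_smoothSqf_eq` (`ℓ ≤ x`, `ℓ ∣ P(z)`, `𝔡 ≤ D`
  through (24.10) `sepDivisor_le_of_smooth` from `z^{r(r-1)} x ≤ D^r`, `m, n ≤ √x` through (24.8)).
* **(24.12)** `sum_sqfLE_eq` and **Proposition 24.2** `sum_sqfLE_eq_sepTriple_add` over any division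
  ring of characteristic zero (`roughCount_prime_mul`: `ν(pq, z) = 1 + ν(q, z)`;
  `roughCount_eq_zero_of_lt`: `γ(q) = 1` for `q < z`).

## References

* J. Friedlander, H. Iwaniec, Ann. of Math. (2) 148 (1998), 945–1040, §24, (24.7)–(24.13), Lemma 24.1,
  Proposition 24.2. [FriedlanderIwaniecAnnals1998]

## Mathlib / tree

Tree: `…SeparationDivisor` (all of (24.1)–(24.8)). Mathlib: `Finset.sum_nbij'`, `Finset.card_nbij'`,
`Finset.sum_fiberwise_of_maps_to`, `Finset.sum_filter_add_sum_filter_not`, `Nat.primeFactors_prod`,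
`Nat.primeFactors_mul`, `Nat.prod_primeFactors_of_squarefree`, `Nat.squarefree_mul_iff`,
`Nat.Ioc_filter_dvd_card_eq_div`, `Nat.pow_le_pow_iff_left`, `Nat.le_sqrt`.
-/

open Finset

namespace Literature.NumberTheory.Sieve.FriedlanderIwaniecPrimes

/-! ### Counting the separation indices below a given index -/

/-- The number of separation indices `i < j` (`1 ≤ i`, `i ≤ r ∨ r ∣ i`): for `j > r` it is
`r + (⌊(j-1)/r⌋ - 1)` (the indices `1, …, r` and the multiples `2r, 3r, … < j`).
[cite: FriedlanderIwaniecAnnals1998, (24.2)] -/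
theorem card_Ico_filter_isSepIdx {r j : ℕ} (hr : 0 < r) (hj : r < j) :
    #((Ico 1 j).filter fun i => IsSepIdx r i) = r + ((j - 1) / r - 1) := by
  -- split at `r`
  have hsplit : (Ico 1 j).filter (fun i => IsSepIdx r i) =
      Ico 1 (r + 1) ∪ ((Ioc 0 (j - 1)).filter (fun i => r ∣ i)).erase r := by
    ext i
    simp only [mem_filter, mem_Ico, mem_union, mem_erase, mem_Ioc, IsSepIdx]
    constructor
    · rintro ⟨⟨h1, h2⟩, h | h⟩
      · exact Or.inl ⟨h1, by omega⟩
      · by_cases hi : i ≤ r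
        · exact Or.inl ⟨h1, by omega⟩
        · exact Or.inr ⟨by omega, ⟨by omega, by omega⟩, h⟩
    · rintro (⟨h1, h2⟩ | ⟨hne, ⟨h1, h2⟩, h⟩)
      · exact ⟨⟨h1, by omega⟩, Or.inl (by omega)⟩
      · exact ⟨⟨h1, by omega⟩, Or.inr h⟩
  have hdisj : Disjoint (Ico 1 (r + 1)) (((Ioc 0 (j - 1)).filter (fun i => r ∣ i)).erase r) := by
    rw [disjoint_left]
    intro i hi hi'
    rw [mem_Ico] at hi
    rw [mem_erase, mem_filter] at hi'
    have := Nat.le_of_dvd (by omega) hi'.2.2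
    omega
  rw [hsplit, card_union_of_disjoint hdisj, Nat.card_Ico, card_erase_of_mem, Nat.Ioc_filter_dvd_card_eq_div]
  · omega
  · exact mem_filter.mpr ⟨mem_Ioc.mpr ⟨hr, by omega⟩, dvd_refl r⟩

/-- For `j ≤ r + 1` every index below `j` is a separation index. [cite: FriedlanderIwaniecAnnals1998, (24.2)] -/
theorem card_Ico_filter_isSepIdx_of_le {r j : ℕ} (hj : j ≤ r + 1) :
    #((Ico 1 j).filter fun i => IsSepIdx r i) = j - 1 := by
  have : (Ico 1 j).filter (fun i => IsSepIdx r i) = Ico 1 j := by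
    refine filter_true_of_mem fun i hi => ?_
    rw [mem_Ico] at hi
    exact Or.inl (by omega)
  rw [this, Nat.card_Ico]

/-! ### The `d`-rank `A_d(p) = #{π ∣ d prime : π > p}` and the blocks relative to `d` -/

/-- `A_d(p)`: the number of prime factors of `d` above `p` (so `A_d = primeIdx d - 1`; for the
separation divisor `d = 𝔡 = π₁ π₂ ⋯`, a prime `p ∉ 𝔡` lies in the block `(π_{r+k}, π_{r+k-1})` with
`k = A_𝔡(p) + 1 - r`). [cite: FriedlanderIwaniecAnnals1998, §24 ((𝔡⁺), (𝔡⁻))] -/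
def dRank (d p : ℕ) : ℕ := #(d.primeFactors.filter (p < ·))

/-- Unfolding `dRank`. [cite: FriedlanderIwaniecAnnals1998, §24 ((𝔡⁺), (𝔡⁻))] -/
theorem dRank_def (d p : ℕ) : dRank d p = #(d.primeFactors.filter (p < ·)) := rfl

/-- `primeIdx d p = A_d(p) + 1`. [cite: FriedlanderIwaniecAnnals1998, (24.1)] -/
theorem primeIdx_eq_dRank_add_one (d p : ℕ) : primeIdx d p = dRank d p + 1 := rfl

/-- `A_d(p) ≤ ω(d)`. [cite: FriedlanderIwaniecAnnals1998, §24 ((𝔡⁺), (𝔡⁻))] -/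
theorem dRank_le (d p : ℕ) : dRank d p ≤ #d.primeFactors := card_le_card (filter_subset _ _)

/-- `A_d` is antitone. [cite: FriedlanderIwaniecAnnals1998, §24 ((𝔡⁺), (𝔡⁻))] -/
theorem dRank_le_of_le {d p q : ℕ} (h : p ≤ q) : dRank d q ≤ dRank d p :=
  card_le_card fun x hx => by
    rw [mem_filter] at hx ⊢; exact ⟨hx.1, lt_of_le_of_lt h hx.2⟩

/-! ### The rank of a prime of `ℓ` relative to `𝔡(ℓ)` -/

section

variable {r ℓ : ℕ}

/-- The prime factors of `𝔡(ℓ)` are the prime factors of `ℓ` with a separation index.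
[cite: FriedlanderIwaniecAnnals1998, (24.2)] -/
theorem primeFactors_sepDivisor :
    (sepDivisor r ℓ).primeFactors = ℓ.primeFactors.filter fun q => IsSepIdx r (primeIdx ℓ q) := by
  rw [sepDivisor]
  exact Nat.primeFactors_prod fun p hp => Nat.prime_of_mem_primeFactors (mem_filter.mp hp).1

/-- The prime factors of `m(ℓ)`. [cite: FriedlanderIwaniecAnnals1998, (24.4)] -/
theorem primeFactors_plusPart :
    (plusPart r ℓ).primeFactors = ℓ.primeFactors.filter fun q => IsPlusIdx r (primeIdx ℓ q) := by
  rw [plusPart]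
  exact Nat.primeFactors_prod fun p hp => Nat.prime_of_mem_primeFactors (mem_filter.mp hp).1

/-- The prime factors of `n(ℓ)`. [cite: FriedlanderIwaniecAnnals1998, (24.5)] -/
theorem primeFactors_minusPart :
    (minusPart r ℓ).primeFactors = ℓ.primeFactors.filter fun q => IsMinusIdx r (primeIdx ℓ q) := by
  rw [minusPart]
  exact Nat.primeFactors_prod fun p hp => Nat.prime_of_mem_primeFactors (mem_filter.mp hp).1

/-- **The `𝔡(ℓ)`-rank of a prime factor of `ℓ` is the number of separation indices below its
index**: `A_{𝔡(ℓ)}(p) = #{i < idx p : i ≤ r ∨ r ∣ i}` (the primes of `𝔡(ℓ)` above `p` are the `p_i`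
with `i < idx p` a separation index). [cite: FriedlanderIwaniecAnnals1998, (24.2)] -/
theorem dRank_sepDivisor_eq {p : ℕ} (hp : p ∈ ℓ.primeFactors) :
    dRank (sepDivisor r ℓ) p = #((Ico 1 (primeIdx ℓ p)).filter fun i => IsSepIdx r i) := by
  rw [dRank_def]
  -- the prime factors of `𝔡(ℓ)`
  have hpf := primeFactors_sepDivisor (r := r) (ℓ := ℓ)
  rw [hpf, filter_filter]
  -- biject with the separation indices below `idx p` through `primeIdx ℓ`
  have hinj : Set.InjOn (primeIdx ℓ) (ℓ.primeFactors.filter fun q => IsSepIdx r (primeIdx ℓ q) ∧ p < q) :=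
    fun q hq q' hq' h => primeIdx_injOn ℓ (mem_filter.mp hq).1 (mem_filter.mp hq').1 h
  rw [← card_image_of_injOn hinj]
  congr 1
  ext i
  simp only [mem_image, mem_filter, mem_Ico]
  constructor
  · rintro ⟨q, ⟨hq, hs, hpq⟩, rfl⟩
    exact ⟨⟨one_le_primeIdx ℓ q, primeIdx_lt_of_lt hq hpq⟩, hs⟩
  · rintro ⟨⟨h1, h2⟩, hs⟩
    obtain ⟨q, hq, hqi⟩ := exists_primeIdx_eq (ℓ := ℓ) h1 (by have := primeIdx_le_card hp; omega)
    refine ⟨q, ⟨hq, hqi ▸ hs, ?_⟩, hqi⟩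
    rw [lt_iff_primeIdx_lt hp hq, hqi]; exact h2

/-- For a prime of `ℓ` with index `j > r`: `A_{𝔡(ℓ)}(p) = r + ⌊(j-1)/r⌋ - 1`, i.e. its block relative
to `𝔡(ℓ)` is `⌊(j-1)/r⌋`. [cite: FriedlanderIwaniecAnnals1998, §24 ((𝔡⁺), (𝔡⁻))] -/
theorem dRank_sepDivisor_eq_of_lt (hr : 0 < r) {p : ℕ} (hp : p ∈ ℓ.primeFactors)
    (hj : r < primeIdx ℓ p) : dRank (sepDivisor r ℓ) p = r + ((primeIdx ℓ p - 1) / r - 1) := by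
  rw [dRank_sepDivisor_eq hp, card_Ico_filter_isSepIdx hr hj]

/-- For a prime of `ℓ` with index `j ≤ r + 1`: `A_{𝔡(ℓ)}(p) = j - 1`.
[cite: FriedlanderIwaniecAnnals1998, §24 ((𝔡⁺), (𝔡⁻))] -/
theorem dRank_sepDivisor_eq_of_le {p : ℕ} (hp : p ∈ ℓ.primeFactors)
    (hj : primeIdx ℓ p ≤ r + 1) : dRank (sepDivisor r ℓ) p = primeIdx ℓ p - 1 := by
  rw [dRank_sepDivisor_eq hp, card_Ico_filter_isSepIdx_of_le hj]

/-- The number of prime factors of `𝔡(ℓ)`: `ω(𝔡) = r + ⌊J/r⌋ - 1` if `J = ω(ℓ) ≥ r`, and `= J`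
otherwise. [cite: FriedlanderIwaniecAnnals1998, (24.2)] -/
theorem card_primeFactors_sepDivisor :
    #(sepDivisor r ℓ).primeFactors = #((Ico 1 (#ℓ.primeFactors + 1)).filter fun i => IsSepIdx r i) := by
  have hpf := primeFactors_sepDivisor (r := r) (ℓ := ℓ)
  rw [hpf]
  have hinj : Set.InjOn (primeIdx ℓ) (ℓ.primeFactors.filter fun q => IsSepIdx r (primeIdx ℓ q)) :=
    fun q hq q' hq' h => primeIdx_injOn ℓ (mem_filter.mp hq).1 (mem_filter.mp hq').1 h
  rw [← card_image_of_injOn hinj]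
  congr 1
  ext i
  simp only [mem_image, mem_filter, mem_Ico]
  constructor
  · rintro ⟨q, ⟨hq, hs⟩, rfl⟩
    exact ⟨⟨one_le_primeIdx ℓ q, Nat.lt_succ_of_le (primeIdx_le_card hq)⟩, hs⟩
  · rintro ⟨⟨h1, h2⟩, hs⟩
    obtain ⟨q, hq, hqi⟩ := exists_primeIdx_eq (ℓ := ℓ) h1 (by omega)
    exact ⟨q, ⟨hq, hqi ▸ hs⟩, hqi⟩

/-- Counting prime factors by their indices: `#{p ∣ ℓ : idx p ∈ S} = #(S ∩ [1, ω(ℓ)])`.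
[cite: FriedlanderIwaniecAnnals1998, (24.1)] -/
theorem card_filter_primeIdx_mem (ℓ : ℕ) (S : Finset ℕ) :
    #(ℓ.primeFactors.filter fun p => primeIdx ℓ p ∈ S) = #((Icc 1 #ℓ.primeFactors).filter (· ∈ S)) := by
  have hinj : Set.InjOn (primeIdx ℓ) (ℓ.primeFactors.filter fun p => primeIdx ℓ p ∈ S) :=
    fun q hq q' hq' h => primeIdx_injOn ℓ (mem_filter.mp hq).1 (mem_filter.mp hq').1 h
  rw [← card_image_of_injOn hinj]
  congr 1
  ext j
  simp only [mem_image, mem_filter, mem_Icc]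
  constructor
  · rintro ⟨q, ⟨hq, hs⟩, rfl⟩
    exact ⟨⟨one_le_primeIdx ℓ q, primeIdx_le_card hq⟩, hs⟩
  · rintro ⟨⟨h1, h2⟩, hs⟩
    obtain ⟨q, hq, hqi⟩ := exists_primeIdx_eq (ℓ := ℓ) h1 h2
    exact ⟨q, ⟨hq, hqi ▸ hs⟩, hqi⟩

end

/-! ### The conditions `(𝔡⁺)` and `(𝔡⁻)` -/

section

variable (r : ℕ)

/-- The block of a prime `p` relative to `d = π₁ π₂ ⋯` (decreasing): `K_d(p) = A_d(p) + 1 - r`, so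
that `K_d(p) = k ≥ 1` means `π_{r+k} < p < π_{r+k-1}` (with `π_{ω(d)+1} = 1`).
[cite: FriedlanderIwaniecAnnals1998, §24 ((𝔡⁺), (𝔡⁻))] -/
def dBlock (d p : ℕ) : ℕ := dRank d p + 1 - r

/-- **Condition `(𝔡⁺)`** on `m` relative to a prospective separation divisor `d = π₁ > π₂ > ⋯`
(source: "the first largest `r - 1` prime divisors of `m` are in `(π_{r+1}, π_r)`, the second largest
`r - 1` prime divisors of `m` are in `(π_{r+3}, π_{r+2})`, and so on"), made precise: `m` is
squarefree; every prime of `m` is prime to `d`, lies below `π_r`, in an odd block; every odd block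
`k` with `r + k ≤ ω(d)` (a block bounded below by a prime of `d`) contains exactly `r - 1` primes of
`m`; and the bottom block (below all primes of `d`) contains at most `r - 1` primes of `m` ("the
product terminates when it runs out of primes"). [cite: FriedlanderIwaniecAnnals1998, §24 (𝔡⁺)] -/
def IsPlusAdm (d m : ℕ) : Prop :=
  Squarefree m ∧
  (∀ p ∈ m.primeFactors, p ∉ d.primeFactors ∧ r ≤ dRank d p ∧ Odd (dBlock r d p)) ∧
  (∀ k, Odd k → k + r ≤ #d.primeFactors → #(m.primeFactors.filter fun p => dBlock r d p = k) = r - 1) ∧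
  #(m.primeFactors.filter fun p => dRank d p = #d.primeFactors) ≤ r - 1

/-- **Condition `(𝔡⁻)`** on `n` (source: "the first largest `r - 1` prime divisors of `n` are in
`(π_{r+2}, π_{r+1})`, the second largest `r - 1` prime divisors of `n` are in `(π_{r+4}, π_{r+3})`, and
so on"): as `(𝔡⁺)` with even blocks. [cite: FriedlanderIwaniecAnnals1998, §24 (𝔡⁻)] -/
def IsMinusAdm (d n : ℕ) : Prop :=
  Squarefree n ∧
  (∀ p ∈ n.primeFactors, p ∉ d.primeFactors ∧ r ≤ dRank d p ∧ Even (dBlock r d p)) ∧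
  (∀ k, Even k → 1 ≤ k → k + r ≤ #d.primeFactors → #(n.primeFactors.filter fun p => dBlock r d p = k) = r - 1) ∧
  #(n.primeFactors.filter fun p => dRank d p = #d.primeFactors) ≤ r - 1

/-- `(𝔡⁺)` is a decidable condition (classically; the sums below are noncomputable anyway). [folklore] -/
noncomputable instance (d m : ℕ) : Decidable (IsPlusAdm r d m) := Classical.dec _

/-- `(𝔡⁻)` is a decidable condition (classically). [folklore] -/
noncomputable instance (d n : ℕ) : Decidable (IsMinusAdm r d n) := Classical.dec _

end

/-! ### `m(ℓ)` satisfies `(𝔡(ℓ)⁺)` and `n(ℓ)` satisfies `(𝔡(ℓ)⁻)` -/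

section

variable {r ℓ : ℕ}

/-- `m(ℓ) ∣ ℓ` for squarefree `ℓ`. [cite: FriedlanderIwaniecAnnals1998, (24.7)] -/
theorem plusPart_dvd (hℓ : Squarefree ℓ) : plusPart r ℓ ∣ ℓ :=
  ⟨sepDivisor r ℓ * minusPart r ℓ, by
    conv_lhs => rw [← sepDivisor_mul_plusPart_mul_minusPart r hℓ]
    ring⟩

/-- `n(ℓ) ∣ ℓ` for squarefree `ℓ`. [cite: FriedlanderIwaniecAnnals1998, (24.7)] -/
theorem minusPart_dvd (hℓ : Squarefree ℓ) : minusPart r ℓ ∣ ℓ :=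
  ⟨sepDivisor r ℓ * plusPart r ℓ, by
    conv_lhs => rw [← sepDivisor_mul_plusPart_mul_minusPart r hℓ]
    ring⟩

/-- `𝔡(ℓ) ∣ ℓ` for squarefree `ℓ`. [cite: FriedlanderIwaniecAnnals1998, (24.7)] -/
theorem sepDivisor_dvd (hℓ : Squarefree ℓ) : sepDivisor r ℓ ∣ ℓ :=
  ⟨plusPart r ℓ * minusPart r ℓ, by
    conv_lhs => rw [← sepDivisor_mul_plusPart_mul_minusPart r hℓ]
    ring⟩

/-- The block of a prime of `m(ℓ)` or `n(ℓ)` (index `j > r`) relative to `𝔡(ℓ)` is `⌊(j-1)/r⌋`, and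
its rank is `≥ r`. [cite: FriedlanderIwaniecAnnals1998, §24 ((𝔡⁺), (𝔡⁻))] -/
theorem dBlock_sepDivisor_eq (hr : 0 < r) {p : ℕ} (hp : p ∈ ℓ.primeFactors) (hj : r < primeIdx ℓ p) :
    r ≤ dRank (sepDivisor r ℓ) p ∧ dBlock r (sepDivisor r ℓ) p = (primeIdx ℓ p - 1) / r := by
  have h := dRank_sepDivisor_eq_of_lt hr hp hj
  have hb1 : 1 ≤ (primeIdx ℓ p - 1) / r := (Nat.le_div_iff_mul_le hr).mpr (by omega)
  refine ⟨by omega, ?_⟩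
  rw [dBlock, h]; omega

/-- The number of prime factors of `𝔡(ℓ)` when `ω(ℓ) ≥ r`: `ω(𝔡) = r + (⌊ω(ℓ)/r⌋ - 1)`.
[cite: FriedlanderIwaniecAnnals1998, (24.2)] -/
theorem card_primeFactors_sepDivisor_of_le (hr : 0 < r) (hJ : r ≤ #ℓ.primeFactors) :
    #(sepDivisor r ℓ).primeFactors = r + (#ℓ.primeFactors / r - 1) := by
  rw [card_primeFactors_sepDivisor, card_Ico_filter_isSepIdx hr (Nat.lt_succ_of_le hJ)]
  simp

/-- The primes of `m(ℓ)`/`n(ℓ)` in block `k` relative to `𝔡(ℓ)` are the `p_j` with `kr < j < (k+1)r`.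
[cite: FriedlanderIwaniecAnnals1998, §24 ((𝔡⁺), (𝔡⁻))] -/
theorem filter_dBlock_eq (hr : 0 < r) {k : ℕ} (P : ℕ → Prop) [DecidablePred P]
    (hP : ∀ j, P j → r < j ∧ ¬ r ∣ j) (hP' : ∀ j, k * r < j → j < (k + 1) * r → P j) :
    ((ℓ.primeFactors.filter fun q => P (primeIdx ℓ q)).filter fun p => dBlock r (sepDivisor r ℓ) p = k) =
      ℓ.primeFactors.filter fun p => primeIdx ℓ p ∈ Ioo (k * r) ((k + 1) * r) := by
  rw [filter_filter]
  refine filter_congr fun p hp => ?_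
  rw [mem_Ioo]
  have ekr : (k + 1) * r = k * r + r := by ring
  constructor
  · rintro ⟨h1, h2⟩
    obtain ⟨hj, hndvd⟩ := hP _ h1
    rw [(dBlock_sepDivisor_eq hr hp hj).2] at h2
    have h3 := Nat.div_mul_le_self (primeIdx ℓ p - 1) r
    have h4 := Nat.lt_div_mul_add (a := primeIdx ℓ p - 1) hr
    rw [h2] at h3 h4
    have hne : primeIdx ℓ p ≠ (k + 1) * r := fun h => hndvd ⟨k + 1, by rw [h, mul_comm]⟩
    rw [ekr] at hne ⊢
    generalize k * r = kr at h3 h4 hne ⊢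
    omega
  · rintro ⟨h1, h2⟩
    have hPj := hP' _ h1 h2
    obtain ⟨hj, -⟩ := hP _ hPj
    refine ⟨hPj, ?_⟩
    rw [(dBlock_sepDivisor_eq hr hp hj).2]
    refine Nat.div_eq_of_lt_le ?_ ?_
    · generalize k * r = kr at h1 ⊢; omega
    · rw [ekr] at h2 ⊢; generalize k * r = kr at h1 h2 ⊢; omega

/-- **`m(ℓ)` satisfies `(𝔡(ℓ)⁺)`** for squarefree `ℓ` and `r ≥ 2`.
[cite: FriedlanderIwaniecAnnals1998, §24 (𝔡⁺), (24.7)] -/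
theorem isPlusAdm_plusPart (hr : 2 ≤ r) (hℓ : Squarefree ℓ) :
    IsPlusAdm r (sepDivisor r ℓ) (plusPart r ℓ) := by
  have hr0 : 0 < r := by omega
  refine ⟨hℓ.squarefree_of_dvd (plusPart_dvd hℓ), ?_, ?_, ?_⟩
  · intro p hp
    rw [primeFactors_plusPart, mem_filter] at hp
    obtain ⟨hp, hj, hndvd, hodd⟩ := hp
    have hb := dBlock_sepDivisor_eq hr0 hp hj
    refine ⟨?_, hb.1, hb.2 ▸ hodd⟩
    rw [primeFactors_sepDivisor, mem_filter]
    exact fun h => not_isPlusIdx_of_isSepIdx r h.2 ⟨hj, hndvd, hodd⟩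
  · intro k hk hkt
    have hk1 : 1 ≤ k := hk.pos
    -- `k + r ≤ ω(𝔡)` forces `(k+1) r ≤ ω(ℓ)`
    have hJ : r ≤ #ℓ.primeFactors := by
      by_contra h
      rw [not_le] at h
      have : #(sepDivisor r ℓ).primeFactors ≤ #ℓ.primeFactors := by
        rw [primeFactors_sepDivisor]; exact card_le_card (filter_subset _ _)
      omega
    rw [card_primeFactors_sepDivisor_of_le hr0 hJ] at hkt
    have hkJ : (k + 1) * r ≤ #ℓ.primeFactors := by
      have h1 : k + 1 ≤ #ℓ.primeFactors / r := by omega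
      exact (Nat.le_div_iff_mul_le hr0).mp h1
    have ekr : (k + 1) * r = k * r + r := by ring
    have hkr : r ≤ k * r := Nat.le_mul_of_pos_left r hk1
    have hP' : ∀ j, k * r < j → j < (k + 1) * r → IsPlusIdx r j := by
      intro j h1 h2
      rw [ekr] at h2
      refine ⟨by omega, fun ⟨c, hc⟩ => ?_, ?_⟩
      · rcases Nat.lt_or_ge c (k + 1) with h | h
        · have : r * c ≤ r * k := Nat.mul_le_mul_left r (by omega)
          rw [mul_comm r k] at this; omega
        · have : r * (k + 1) ≤ r * c := Nat.mul_le_mul_left r h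
          rw [mul_comm r (k + 1), ekr] at this; omega
      · rw [Nat.div_eq_of_lt_le (k := k) (by generalize k * r = kr at h1 ⊢; omega)
          (by rw [ekr]; generalize k * r = kr at h1 h2 ⊢; omega)]
        exact hk
    rw [primeFactors_plusPart, filter_dBlock_eq hr0 (IsPlusIdx r) (fun j h => ⟨h.1, h.2.1⟩) hP',
      card_filter_primeIdx_mem]
    have : (Icc 1 #ℓ.primeFactors).filter (· ∈ Ioo (k * r) ((k + 1) * r)) = Ioo (k * r) ((k + 1) * r) := by
      ext j; simp only [mem_filter, mem_Icc, mem_Ioo]; constructor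
      · rintro ⟨-, h⟩; exact h
      · rintro ⟨h1, h2⟩
        exact ⟨⟨by generalize k * r = kr at h1 hkr ⊢; omega, by omega⟩, h1, h2⟩
    rw [this, Nat.card_Ioo, ekr]
    generalize k * r = kr
    omega
  · -- the bottom block: indices in `(⌊J/r⌋ r, J]`, at most `J mod r ≤ r - 1` of them
    rcases Nat.lt_or_ge #ℓ.primeFactors r with hJ | hJ
    · -- fewer than `r` primes: `m = 1`
      have : (plusPart r ℓ).primeFactors = ∅ := by
        rw [primeFactors_plusPart, filter_eq_empty_iff]
        intro p hp h
        have := primeIdx_le_card hp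
        exact absurd h.1 (by omega)
      rw [this, filter_empty, card_empty]; omega
    have hk01 : 1 ≤ #ℓ.primeFactors / r := (Nat.le_div_iff_mul_le hr0).mpr (by omega)
    have hsub : ((plusPart r ℓ).primeFactors.filter fun p => dRank (sepDivisor r ℓ) p = #(sepDivisor r ℓ).primeFactors) ⊆
        ℓ.primeFactors.filter fun p => primeIdx ℓ p ∈ Ioc (#ℓ.primeFactors / r * r) #ℓ.primeFactors := by
      intro p hp
      rw [mem_filter, primeFactors_plusPart, mem_filter] at hp
      obtain ⟨⟨hp, hj, -, -⟩, hd⟩ := hp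
      rw [card_primeFactors_sepDivisor_of_le hr0 hJ, dRank_sepDivisor_eq_of_lt hr0 hp hj] at hd
      have hb1 : 1 ≤ (primeIdx ℓ p - 1) / r := (Nat.le_div_iff_mul_le hr0).mpr (by omega)
      have hblk : (primeIdx ℓ p - 1) / r = #ℓ.primeFactors / r := by omega
      refine mem_filter.mpr ⟨hp, mem_Ioc.mpr ⟨?_, primeIdx_le_card hp⟩⟩
      have := Nat.div_mul_le_self (primeIdx ℓ p - 1) r
      rw [hblk] at this; omega
    refine (card_le_card hsub).trans ?_
    rw [card_filter_primeIdx_mem]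
    have : (Icc 1 #ℓ.primeFactors).filter (· ∈ Ioc (#ℓ.primeFactors / r * r) #ℓ.primeFactors) =
        Ioc (#ℓ.primeFactors / r * r) #ℓ.primeFactors := by
      ext j; simp only [mem_filter, mem_Icc, mem_Ioc]; constructor
      · rintro ⟨-, h⟩; exact h
      · rintro ⟨h1, h2⟩; exact ⟨⟨by omega, h2⟩, h1, h2⟩
    rw [this, Nat.card_Ioc]
    have h1 := Nat.lt_div_mul_add (a := #ℓ.primeFactors) hr0
    omega

/-- **`n(ℓ)` satisfies `(𝔡(ℓ)⁻)`** for squarefree `ℓ` and `r ≥ 2`.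
[cite: FriedlanderIwaniecAnnals1998, §24 (𝔡⁻), (24.7)] -/
theorem isMinusAdm_minusPart (hr : 2 ≤ r) (hℓ : Squarefree ℓ) :
    IsMinusAdm r (sepDivisor r ℓ) (minusPart r ℓ) := by
  have hr0 : 0 < r := by omega
  refine ⟨hℓ.squarefree_of_dvd (minusPart_dvd hℓ), ?_, ?_, ?_⟩
  · intro p hp
    rw [primeFactors_minusPart, mem_filter] at hp
    obtain ⟨hp, hj, hndvd, hodd⟩ := hp
    have hb := dBlock_sepDivisor_eq hr0 hp hj
    refine ⟨?_, hb.1, hb.2 ▸ hodd⟩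
    rw [primeFactors_sepDivisor, mem_filter]
    exact fun h => not_isMinusIdx_of_isSepIdx r h.2 ⟨hj, hndvd, hodd⟩
  · intro k hk hk1 hkt
    -- `k + r ≤ ω(𝔡)` forces `(k+1) r ≤ ω(ℓ)`
    have hJ : r ≤ #ℓ.primeFactors := by
      by_contra h
      rw [not_le] at h
      have : #(sepDivisor r ℓ).primeFactors ≤ #ℓ.primeFactors := by
        rw [primeFactors_sepDivisor]; exact card_le_card (filter_subset _ _)
      omega
    rw [card_primeFactors_sepDivisor_of_le hr0 hJ] at hkt
    have hkJ : (k + 1) * r ≤ #ℓ.primeFactors := by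
      have h1 : k + 1 ≤ #ℓ.primeFactors / r := by omega
      exact (Nat.le_div_iff_mul_le hr0).mp h1
    have ekr : (k + 1) * r = k * r + r := by ring
    have hkr : r ≤ k * r := Nat.le_mul_of_pos_left r hk1
    have hP' : ∀ j, k * r < j → j < (k + 1) * r → IsMinusIdx r j := by
      intro j h1 h2
      rw [ekr] at h2
      refine ⟨by omega, fun ⟨c, hc⟩ => ?_, ?_⟩
      · rcases Nat.lt_or_ge c (k + 1) with h | h
        · have : r * c ≤ r * k := Nat.mul_le_mul_left r (by omega)
          rw [mul_comm r k] at this; omega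
        · have : r * (k + 1) ≤ r * c := Nat.mul_le_mul_left r h
          rw [mul_comm r (k + 1), ekr] at this; omega
      · rw [Nat.div_eq_of_lt_le (k := k) (by generalize k * r = kr at h1 ⊢; omega)
          (by rw [ekr]; generalize k * r = kr at h1 h2 ⊢; omega)]
        exact hk
    rw [primeFactors_minusPart, filter_dBlock_eq hr0 (IsMinusIdx r) (fun j h => ⟨h.1, h.2.1⟩) hP',
      card_filter_primeIdx_mem]
    have : (Icc 1 #ℓ.primeFactors).filter (· ∈ Ioo (k * r) ((k + 1) * r)) = Ioo (k * r) ((k + 1) * r) := by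
      ext j; simp only [mem_filter, mem_Icc, mem_Ioo]; constructor
      · rintro ⟨-, h⟩; exact h
      · rintro ⟨h1, h2⟩
        exact ⟨⟨by generalize k * r = kr at h1 hkr ⊢; omega, by omega⟩, h1, h2⟩
    rw [this, Nat.card_Ioo, ekr]
    generalize k * r = kr
    omega
  · -- the bottom block: indices in `(⌊J/r⌋ r, J]`, at most `J mod r ≤ r - 1` of them
    rcases Nat.lt_or_ge #ℓ.primeFactors r with hJ | hJ
    · -- fewer than `r` primes: `n = 1`
      have : (minusPart r ℓ).primeFactors = ∅ := by
        rw [primeFactors_minusPart, filter_eq_empty_iff]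
        intro p hp h
        have := primeIdx_le_card hp
        exact absurd h.1 (by omega)
      rw [this, filter_empty, card_empty]; omega
    have hk01 : 1 ≤ #ℓ.primeFactors / r := (Nat.le_div_iff_mul_le hr0).mpr (by omega)
    have hsub : ((minusPart r ℓ).primeFactors.filter fun p => dRank (sepDivisor r ℓ) p = #(sepDivisor r ℓ).primeFactors) ⊆
        ℓ.primeFactors.filter fun p => primeIdx ℓ p ∈ Ioc (#ℓ.primeFactors / r * r) #ℓ.primeFactors := by
      intro p hp
      rw [mem_filter, primeFactors_minusPart, mem_filter] at hp
      obtain ⟨⟨hp, hj, -, -⟩, hd⟩ := hp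
      rw [card_primeFactors_sepDivisor_of_le hr0 hJ, dRank_sepDivisor_eq_of_lt hr0 hp hj] at hd
      have hb1 : 1 ≤ (primeIdx ℓ p - 1) / r := (Nat.le_div_iff_mul_le hr0).mpr (by omega)
      have hblk : (primeIdx ℓ p - 1) / r = #ℓ.primeFactors / r := by omega
      refine mem_filter.mpr ⟨hp, mem_Ioc.mpr ⟨?_, primeIdx_le_card hp⟩⟩
      have := Nat.div_mul_le_self (primeIdx ℓ p - 1) r
      rw [hblk] at this; omega
    refine (card_le_card hsub).trans ?_
    rw [card_filter_primeIdx_mem]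
    have : (Icc 1 #ℓ.primeFactors).filter (· ∈ Ioc (#ℓ.primeFactors / r * r) #ℓ.primeFactors) =
        Ioc (#ℓ.primeFactors / r * r) #ℓ.primeFactors := by
      ext j; simp only [mem_filter, mem_Icc, mem_Ioc]; constructor
      · rintro ⟨-, h⟩; exact h
      · rintro ⟨h1, h2⟩; exact ⟨⟨by omega, h2⟩, h1, h2⟩
    rw [this, Nat.card_Ioc]
    have h1 := Nat.lt_div_mul_add (a := #ℓ.primeFactors) hr0
    omega

end

/-! ### Uniqueness: an admissible triple `(d, m, n)` is the separation factorisation of `d m n` -/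

section Uniqueness

variable {r d m n : ℕ}

/-- Coprimality from disjoint prime supports. [folklore] -/
theorem coprime_of_primeFactors_disjoint {a b : ℕ} (ha : a ≠ 0) (hb : b ≠ 0)
    (h : Disjoint a.primeFactors b.primeFactors) : a.Coprime b := by
  rw [Nat.coprime_iff_gcd_eq_one]
  by_contra hg
  obtain ⟨p, hp, hpd⟩ := Nat.exists_prime_and_dvd hg
  have hpa : p ∈ a.primeFactors := Nat.mem_primeFactors.mpr ⟨hp, hpd.trans (Nat.gcd_dvd_left a b), ha⟩
  have hpb : p ∈ b.primeFactors := Nat.mem_primeFactors.mpr ⟨hp, hpd.trans (Nat.gcd_dvd_right a b), hb⟩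
  exact disjoint_left.mp h hpa hpb

/-- `m` is prime to `d` under `(𝔡⁺)`. [cite: FriedlanderIwaniecAnnals1998, (24.7)] -/
theorem IsPlusAdm.disjoint (hm : IsPlusAdm r d m) : Disjoint m.primeFactors d.primeFactors :=
  disjoint_left.mpr fun p hp hpd => (hm.2.1 p hp).1 hpd

/-- `n` is prime to `d` under `(𝔡⁻)`. [cite: FriedlanderIwaniecAnnals1998, (24.7)] -/
theorem IsMinusAdm.disjoint (hn : IsMinusAdm r d n) : Disjoint n.primeFactors d.primeFactors :=
  disjoint_left.mpr fun p hp hpd => (hn.2.1 p hp).1 hpd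

/-- `m` and `n` have disjoint prime supports (odd versus even blocks).
[cite: FriedlanderIwaniecAnnals1998, (24.7)] -/
theorem disjoint_of_adm (hm : IsPlusAdm r d m) (hn : IsMinusAdm r d n) :
    Disjoint m.primeFactors n.primeFactors :=
  disjoint_left.mpr fun p hpm hpn => (Nat.not_even_iff_odd.mpr (hm.2.1 p hpm).2.2) (hn.2.1 p hpn).2.2

/-- `d m n` is squarefree for `d` squarefree and `(m, n)` admissible.
[cite: FriedlanderIwaniecAnnals1998, (24.7)] -/
theorem squarefree_of_adm (hd : Squarefree d) (hm : IsPlusAdm r d m) (hn : IsMinusAdm r d n) :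
    Squarefree (d * m * n) := by
  have hd0 := hd.ne_zero
  have hm0 := hm.1.ne_zero
  have hn0 := hn.1.ne_zero
  rw [Nat.squarefree_mul_iff, Nat.squarefree_mul_iff]
  refine ⟨?_, ⟨coprime_of_primeFactors_disjoint hd0 hm0 hm.disjoint.symm, hd, hm.1⟩, hn.1⟩
  rw [Nat.coprime_mul_iff_left]
  exact ⟨coprime_of_primeFactors_disjoint hd0 hn0 hn.disjoint.symm,
    coprime_of_primeFactors_disjoint hm0 hn0 (disjoint_of_adm hm hn)⟩

/-- The prime factors of `d m n`. [cite: FriedlanderIwaniecAnnals1998, (24.7)] -/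
theorem primeFactors_of_adm (hd : Squarefree d) (hm : IsPlusAdm r d m) (hn : IsMinusAdm r d n) :
    (d * m * n).primeFactors = d.primeFactors ∪ m.primeFactors ∪ n.primeFactors := by
  rw [Nat.primeFactors_mul (mul_ne_zero hd.ne_zero hm.1.ne_zero) hn.1.ne_zero,
    Nat.primeFactors_mul hd.ne_zero hm.1.ne_zero]

/-- **The index of a prime of `ℓ = d m n` splits** as
`idx_ℓ q = A_d(q) + #{p ∣ m : p > q} + #{p ∣ n : p > q} + 1`.
[cite: FriedlanderIwaniecAnnals1998, (24.7)] -/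
theorem primeIdx_of_adm (hd : Squarefree d) (hm : IsPlusAdm r d m) (hn : IsMinusAdm r d n) (q : ℕ) :
    primeIdx (d * m * n) q =
      dRank d q + #(m.primeFactors.filter (q < ·)) + #(n.primeFactors.filter (q < ·)) + 1 := by
  rw [primeIdx_def, primeFactors_of_adm hd hm hn, filter_union, filter_union,
    card_union_of_disjoint, card_union_of_disjoint, dRank_def]
  · exact disjoint_filter_filter hm.disjoint.symm
  · rw [disjoint_union_left]
    exact ⟨disjoint_filter_filter hn.disjoint.symm, disjoint_filter_filter (disjoint_of_adm hm hn)⟩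

/-- For a free prime `p` (rank `≥ r`... any `p ∉ d`) and `π ∣ d`: `π > p ↔ primeIdx d π ≤ A_d(p)`.
[cite: FriedlanderIwaniecAnnals1998, §24 ((𝔡⁺), (𝔡⁻))] -/
theorem lt_iff_primeIdx_le_dRank {p π : ℕ} (hπ : π ∈ d.primeFactors) (hp : p ∉ d.primeFactors) :
    p < π ↔ primeIdx d π ≤ dRank d p := by
  rw [primeIdx_def, dRank_def]
  constructor
  · intro h
    apply card_lt_card
    refine ⟨fun x hx => ?_, fun hsub => ?_⟩
    · rw [mem_filter] at hx ⊢; exact ⟨hx.1, h.trans hx.2⟩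
    · have := hsub (mem_filter.mpr ⟨hπ, h⟩)
      rw [mem_filter] at this; exact lt_irrefl _ this.2
  · intro h
    by_contra hle
    rw [not_lt] at hle
    have hne : π ≠ p := fun e => hp (e ▸ hπ)
    have hlt : π < p := lt_of_le_of_ne hle hne
    have : d.primeFactors.filter (p < ·) ⊆ d.primeFactors.filter (π < ·) := fun x hx => by
      rw [mem_filter] at hx ⊢; exact ⟨hx.1, hlt.trans hx.2⟩
    have := card_le_card this
    omega

/-- Free primes have block `≥ 1`, and `K = k ↔ A = k + r - 1`. [cite: FriedlanderIwaniecAnnals1998, §24 ((𝔡⁺), (𝔡⁻))] -/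
theorem dBlock_eq_iff {p k : ℕ} (hp : r ≤ dRank d p) (hk : 1 ≤ k) :
    dBlock r d p = k ↔ dRank d p = k + r - 1 := by
  rw [dBlock]; omega

/-- The free primes `U = primes of m ∪ primes of n` of block `k ≤ ω(d) - r` number exactly `r - 1`.
[cite: FriedlanderIwaniecAnnals1998, §24 ((𝔡⁺), (𝔡⁻))] -/
theorem card_block_eq (hm : IsPlusAdm r d m) (hn : IsMinusAdm r d n) {k : ℕ} (hk : 1 ≤ k)
    (hkt : k + r ≤ #d.primeFactors) :
    #((m.primeFactors ∪ n.primeFactors).filter fun p => dBlock r d p = k) = r - 1 := by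
  rw [filter_union, card_union_of_disjoint (disjoint_filter_filter (disjoint_of_adm hm hn))]
  rcases Nat.even_or_odd k with he | ho
  · have h0 : m.primeFactors.filter (fun p => dBlock r d p = k) = ∅ :=
      filter_eq_empty_iff.mpr fun p hp h => (Nat.not_even_iff_odd.mpr (hm.2.1 p hp).2.2) (h ▸ he)
    rw [h0, card_empty, zero_add, hn.2.2.1 k he hk hkt]
  · have h0 : n.primeFactors.filter (fun p => dBlock r d p = k) = ∅ :=
      filter_eq_empty_iff.mpr fun p hp h => (Nat.not_odd_iff_even.mpr (hn.2.1 p hp).2.2) (h ▸ ho)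
    rw [h0, card_empty, add_zero, hm.2.2.1 k ho hkt]

/-- Every block of free primes has at most `r - 1` elements (the bottom block included).
[cite: FriedlanderIwaniecAnnals1998, §24 ((𝔡⁺), (𝔡⁻))] -/
theorem card_block_le (hm : IsPlusAdm r d m) (hn : IsMinusAdm r d n) {k : ℕ} (hk : 1 ≤ k) :
    #((m.primeFactors ∪ n.primeFactors).filter fun p => dBlock r d p = k) ≤ r - 1 := by
  rcases Nat.lt_or_ge (#d.primeFactors) (k + r) with hlt | hge
  · -- either the bottom block `k = ω(d) - r + 1` or an empty one above it
    rcases Nat.lt_or_ge (#d.primeFactors + 1) (k + r) with hlt' | hge'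
    · -- empty: `dRank ≤ ω(d)` forces `K ≤ ω(d) + 1 - r < k`
      have : (m.primeFactors ∪ n.primeFactors).filter (fun p => dBlock r d p = k) = ∅ := by
        refine filter_eq_empty_iff.mpr fun p _ h => ?_
        have := dRank_le d p
        rw [dBlock] at h; omega
      rw [this, card_empty]; omega
    · have hkt : k + r = #d.primeFactors + 1 := by omega
      -- bottom block: `K = k ↔ dRank = ω(d)`
      have hiff : ∀ p ∈ m.primeFactors ∪ n.primeFactors, dBlock r d p = k ↔ dRank d p = #d.primeFactors := by
        intro p hp
        have hpr : r ≤ dRank d p := by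
          rcases mem_union.mp hp with h | h
          · exact (hm.2.1 p h).2.1
          · exact (hn.2.1 p h).2.1
        rw [dBlock_eq_iff hpr hk]; omega
      rw [filter_congr hiff, filter_union,
        card_union_of_disjoint (disjoint_filter_filter (disjoint_of_adm hm hn))]
      rcases Nat.even_or_odd k with he | ho
      · have h0 : m.primeFactors.filter (fun p => dRank d p = #d.primeFactors) = ∅ := by
          refine filter_eq_empty_iff.mpr fun p hp h => ?_
          have hb : dBlock r d p = k := by rw [dBlock, h]; omega
          exact (Nat.not_even_iff_odd.mpr (hm.2.1 p hp).2.2) (hb ▸ he)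
        rw [h0, card_empty, zero_add]; exact hn.2.2.2
      · have h0 : n.primeFactors.filter (fun p => dRank d p = #d.primeFactors) = ∅ := by
          refine filter_eq_empty_iff.mpr fun p hp h => ?_
          have hb : dBlock r d p = k := by rw [dBlock, h]; omega
          exact (Nat.not_odd_iff_even.mpr (hn.2.1 p hp).2.2) (hb ▸ ho)
        rw [h0, card_empty, add_zero]; exact hm.2.2.2
  · exact (card_block_eq hm hn hk hge).le

/-- **Cumulative block count**: `#{p free : K(p) ≤ k'} = k'(r - 1)` for `k' ≤ ω(d) - r`.
[cite: FriedlanderIwaniecAnnals1998, §24 ((𝔡⁺), (𝔡⁻))] -/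
theorem card_block_le_eq (hm : IsPlusAdm r d m) (hn : IsMinusAdm r d n) {k' : ℕ}
    (hkt : k' + r ≤ #d.primeFactors) :
    #((m.primeFactors ∪ n.primeFactors).filter fun p => dBlock r d p ≤ k') = k' * (r - 1) := by
  induction k' with
  | zero =>
    rw [zero_mul, card_eq_zero, filter_eq_empty_iff]
    intro p hp h
    have hpr : r ≤ dRank d p := by
      rcases mem_union.mp hp with h | h
      · exact (hm.2.1 p h).2.1
      · exact (hn.2.1 p h).2.1
    rw [dBlock] at h; omega
  | succ k' ih =>
    have hsplit : (m.primeFactors ∪ n.primeFactors).filter (fun p => dBlock r d p ≤ k' + 1) =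
        (m.primeFactors ∪ n.primeFactors).filter (fun p => dBlock r d p ≤ k') ∪
          (m.primeFactors ∪ n.primeFactors).filter (fun p => dBlock r d p = k' + 1) := by
      ext p; simp only [mem_filter, mem_union]
      constructor
      · rintro ⟨hq, h⟩
        rcases Nat.lt_or_ge (dBlock r d p) (k' + 1) with h' | h'
        · exact Or.inl ⟨hq, by omega⟩
        · exact Or.inr ⟨hq, by omega⟩
      · rintro (⟨hq, h⟩ | ⟨hq, h⟩) <;> exact ⟨hq, by omega⟩
    rw [hsplit, card_union_of_disjoint, ih (by omega), card_block_eq hm hn (by omega) (by omega)]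
    · ring
    · rw [disjoint_filter]; intro p _ h; omega

/-- **The free primes above a free prime `p` of block `k`**: those of smaller block, plus those of the
same block above `p`. [cite: FriedlanderIwaniecAnnals1998, §24 ((𝔡⁺), (𝔡⁻))] -/
theorem filter_lt_free_eq (hm : IsPlusAdm r d m) (hn : IsMinusAdm r d n) (p : ℕ) :
    (m.primeFactors ∪ n.primeFactors).filter (p < ·) =
      (m.primeFactors ∪ n.primeFactors).filter (fun q => dBlock r d q < dBlock r d p) ∪
        (m.primeFactors ∪ n.primeFactors).filter (fun q => dBlock r d q = dBlock r d p ∧ p < q) := by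
  have hpr : ∀ q ∈ m.primeFactors ∪ n.primeFactors, r ≤ dRank d q := fun q hq => by
    rcases mem_union.mp hq with h | h
    · exact (hm.2.1 q h).2.1
    · exact (hn.2.1 q h).2.1
  ext q
  simp only [mem_filter, mem_union]
  constructor
  · rintro ⟨hq, hpq⟩
    have hanti : dBlock r d q ≤ dBlock r d p := by
      rw [dBlock, dBlock]; exact Nat.sub_le_sub_right (Nat.add_le_add_right (dRank_le_of_le hpq.le) 1) r
    rcases hanti.lt_or_eq with h | h
    · exact Or.inl ⟨hq, h⟩
    · exact Or.inr ⟨hq, h, hpq⟩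
  · rintro (⟨hq, h⟩ | ⟨hq, -, h⟩)
    · refine ⟨hq, ?_⟩
      by_contra hle
      rw [not_lt] at hle
      have : dBlock r d p ≤ dBlock r d q := by
        rw [dBlock, dBlock]; exact Nat.sub_le_sub_right (Nat.add_le_add_right (dRank_le_of_le hle) 1) r
      omega
    · exact ⟨hq, h⟩

/-- **The index in `ℓ = d m n` of a free prime of block `k`** lies strictly between `kr` and
`(k+1) r`. [cite: FriedlanderIwaniecAnnals1998, (24.7)] -/
theorem primeIdx_free_bounds (hr : 2 ≤ r) (hd : Squarefree d) (hm : IsPlusAdm r d m) (hn : IsMinusAdm r d n)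
    {p : ℕ} (hp : p ∈ m.primeFactors ∪ n.primeFactors) :
    dBlock r d p * r < primeIdx (d * m * n) p ∧ primeIdx (d * m * n) p < dBlock r d p * r + r := by
  set k := dBlock r d p with hk
  have hpr : r ≤ dRank d p := by
    rcases mem_union.mp hp with h | h
    · exact (hm.2.1 p h).2.1
    · exact (hn.2.1 p h).2.1
  have hk1 : 1 ≤ k := by rw [hk, dBlock]; omega
  have hkt : k ≤ #d.primeFactors + 1 - r := by
    have := dRank_le d p; rw [hk, dBlock]; omega
  have hA : dRank d p = k + r - 1 := (dBlock_eq_iff hpr hk1).mp rfl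
  -- the free primes above `p`
  have hU : #(m.primeFactors.filter (p < ·)) + #(n.primeFactors.filter (p < ·)) =
      (k - 1) * (r - 1) + #((m.primeFactors ∪ n.primeFactors).filter fun q => dBlock r d q = k ∧ p < q) := by
    rw [← card_union_of_disjoint (disjoint_filter_filter (disjoint_of_adm hm hn)), ← filter_union,
      filter_lt_free_eq hm hn p, card_union_of_disjoint]
    · congr 1
      have : (m.primeFactors ∪ n.primeFactors).filter (fun q => dBlock r d q < k) =
          (m.primeFactors ∪ n.primeFactors).filter (fun q => dBlock r d q ≤ k - 1) := by
        refine filter_congr fun q _ => ?_; omega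
      rw [this, card_block_le_eq hm hn (k' := k - 1) (by omega)]
    · rw [disjoint_filter]; rintro q _ h ⟨h', -⟩; omega
  -- the same-block primes above `p` are at most `r - 2`
  have hρ : #((m.primeFactors ∪ n.primeFactors).filter fun q => dBlock r d q = k ∧ p < q) ≤ r - 2 := by
    have hsub : (m.primeFactors ∪ n.primeFactors).filter (fun q => dBlock r d q = k ∧ p < q) ⊆
        ((m.primeFactors ∪ n.primeFactors).filter fun q => dBlock r d q = k).erase p := by
      intro q hq
      rw [mem_filter] at hq
      exact mem_erase.mpr ⟨(_root_.ne_of_lt hq.2.2).symm, mem_filter.mpr ⟨hq.1, hq.2.1⟩⟩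
    refine (card_le_card hsub).trans ?_
    have hpk : p ∈ (m.primeFactors ∪ n.primeFactors).filter (fun q => dBlock r d q = k) :=
      mem_filter.mpr ⟨hp, hk.symm⟩
    rw [card_erase_of_mem hpk]
    have := card_block_le hm hn hk1 (m := m) (n := n) (d := d)
    omega
  rw [primeIdx_of_adm hd hm hn, add_assoc (dRank d p), hU, hA]
  have e : (k + r - 1) + (k - 1) * (r - 1) = k * r := by
    have h1 : 1 ≤ k + r := by omega
    zify [hk1, (by omega : 1 ≤ r), h1]
    ring
  constructor
  · rw [← e]; omega
  · have : k + r - 1 + ((k - 1) * (r - 1) + #((m.primeFactors ∪ n.primeFactors).filter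
        fun q => dBlock r d q = k ∧ p < q)) + 1 ≤ k * r + (r - 2) + 1 := by rw [← e]; omega
    omega

/-- **The index in `ℓ = d m n` of a prime `π = π_i` of `d`**: `i` if `i ≤ r`, and `(k'+1) r` if
`i = r + k'`. [cite: FriedlanderIwaniecAnnals1998, (24.7)] -/
theorem primeIdx_sep_eq (hr : 1 ≤ r) (hd : Squarefree d) (hm : IsPlusAdm r d m) (hn : IsMinusAdm r d n)
    {π : ℕ} (hπ : π ∈ d.primeFactors) :
    primeIdx (d * m * n) π =
      if primeIdx d π ≤ r then primeIdx d π else (primeIdx d π - r + 1) * r := by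
  have hfree : ∀ q ∈ m.primeFactors ∪ n.primeFactors, q ∉ d.primeFactors ∧ r ≤ dRank d q := fun q hq => by
    rcases mem_union.mp hq with h | h
    · exact ⟨(hm.2.1 q h).1, (hm.2.1 q h).2.1⟩
    · exact ⟨(hn.2.1 q h).1, (hn.2.1 q h).2.1⟩
  -- free primes above `π`: those with `dRank < primeIdx d π`
  have hU : (m.primeFactors ∪ n.primeFactors).filter (π < ·) =
      (m.primeFactors ∪ n.primeFactors).filter fun q => dRank d q < primeIdx d π := by
    refine filter_congr fun q hq => ?_
    obtain ⟨hqd, -⟩ := hfree q hq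
    have := lt_iff_primeIdx_le_dRank hπ hqd (d := d)
    constructor
    · intro h; by_contra h'; rw [not_lt] at h'
      exact absurd (this.mpr h') (not_lt.mpr h.le)
    · intro h
      rcases lt_trichotomy q π with h' | h' | h'
      · exact absurd (this.mp h') (not_le.mpr h)
      · exact absurd (h' ▸ hπ) hqd
      · exact h'
  have hsum : #(m.primeFactors.filter (π < ·)) + #(n.primeFactors.filter (π < ·)) =
      #((m.primeFactors ∪ n.primeFactors).filter fun q => dRank d q < primeIdx d π) := by
    rw [← card_union_of_disjoint (disjoint_filter_filter (disjoint_of_adm hm hn)), ← filter_union, hU]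
  rw [primeIdx_of_adm hd hm hn, add_assoc (dRank d π), hsum]
  have hiπ := primeIdx_le_card hπ
  split_ifs with hi
  · -- no free prime has rank `< i ≤ r`
    have : (m.primeFactors ∪ n.primeFactors).filter (fun q => dRank d q < primeIdx d π) = ∅ :=
      filter_eq_empty_iff.mpr fun q hq h => absurd ((hfree q hq).2.trans_lt h) (not_lt.mpr hi)
    rw [this, card_empty, add_zero, ← primeIdx_eq_dRank_add_one]
  · rw [not_le] at hi
    -- `dRank q < r + k' ↔ K(q) ≤ k'` with `k' = i - r`
    have : (m.primeFactors ∪ n.primeFactors).filter (fun q => dRank d q < primeIdx d π) =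
        (m.primeFactors ∪ n.primeFactors).filter fun q => dBlock r d q ≤ primeIdx d π - r := by
      refine filter_congr fun q hq => ?_
      have := (hfree q hq).2
      rw [dBlock]; omega
    rw [this, card_block_le_eq hm hn (k' := primeIdx d π - r)
      (show primeIdx d π - r + r ≤ #d.primeFactors by rw [Nat.sub_add_cancel hi.le]; exact hiπ)]
    have e : primeIdx d π = dRank d π + 1 := primeIdx_eq_dRank_add_one d π
    obtain ⟨r₁, rfl⟩ : ∃ r₁, r = r₁ + 1 := ⟨r - 1, by omega⟩
    obtain ⟨k', hk'⟩ : ∃ k', primeIdx d π = k' + r₁ + 2 := ⟨primeIdx d π - r₁ - 2, by omega⟩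
    rw [show primeIdx d π - (r₁ + 1) = k' + 1 by omega, show dRank d π = k' + r₁ + 1 by omega,
      Nat.add_sub_cancel]
    ring

/-- In `ℓ = d m n`, the primes of `d` get separation indices. [cite: FriedlanderIwaniecAnnals1998, (24.7)] -/
theorem isSepIdx_of_mem (hr : 1 ≤ r) (hd : Squarefree d) (hm : IsPlusAdm r d m) (hn : IsMinusAdm r d n)
    {π : ℕ} (hπ : π ∈ d.primeFactors) : IsSepIdx r (primeIdx (d * m * n) π) := by
  rw [primeIdx_sep_eq hr hd hm hn hπ]
  split_ifs with h
  · exact Or.inl h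
  · exact Or.inr (dvd_mul_left r _)

/-- In `ℓ = d m n`, a free prime of block `k` gets an index `j` with `r < j`, `r ∤ j`,
`⌊(j-1)/r⌋ = k`. [cite: FriedlanderIwaniecAnnals1998, (24.7)] -/
theorem primeIdx_free_shape (hr : 2 ≤ r) (hd : Squarefree d) (hm : IsPlusAdm r d m) (hn : IsMinusAdm r d n)
    {p : ℕ} (hp : p ∈ m.primeFactors ∪ n.primeFactors) :
    r < primeIdx (d * m * n) p ∧ ¬ r ∣ primeIdx (d * m * n) p ∧
      (primeIdx (d * m * n) p - 1) / r = dBlock r d p := by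
  obtain ⟨h1, h2⟩ := primeIdx_free_bounds hr hd hm hn hp
  have hpr : r ≤ dRank d p := by
    rcases mem_union.mp hp with h | h
    · exact (hm.2.1 p h).2.1
    · exact (hn.2.1 p h).2.1
  have hk1 : 1 ≤ dBlock r d p := by rw [dBlock]; omega
  set k := dBlock r d p
  have hkr : r ≤ k * r := Nat.le_mul_of_pos_left r hk1
  refine ⟨by omega, ?_, ?_⟩
  · rintro ⟨c, hc⟩
    rw [hc] at h1 h2
    have hc1 : k < c := Nat.lt_of_mul_lt_mul_right (a := r) (by rw [mul_comm c r]; exact h1)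
    have hc2 : c < k + 1 := Nat.lt_of_mul_lt_mul_left (a := r) (by rw [mul_add, mul_one, mul_comm r k]; exact h2)
    omega
  · refine Nat.div_eq_of_lt_le ?_ ?_
    · generalize k * r = kr at h1 ⊢; omega
    · rw [add_mul, one_mul]; generalize k * r = kr at h1 h2 ⊢; omega

/-- In `ℓ = d m n`, the primes of `m` get plus indices. [cite: FriedlanderIwaniecAnnals1998, (24.7)] -/
theorem isPlusIdx_of_mem (hr : 2 ≤ r) (hd : Squarefree d) (hm : IsPlusAdm r d m) (hn : IsMinusAdm r d n)
    {p : ℕ} (hp : p ∈ m.primeFactors) : IsPlusIdx r (primeIdx (d * m * n) p) := by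
  obtain ⟨h1, h2, h3⟩ := primeIdx_free_shape hr hd hm hn (mem_union_left _ hp)
  exact ⟨h1, h2, h3 ▸ (hm.2.1 p hp).2.2⟩

/-- In `ℓ = d m n`, the primes of `n` get minus indices. [cite: FriedlanderIwaniecAnnals1998, (24.7)] -/
theorem isMinusIdx_of_mem (hr : 2 ≤ r) (hd : Squarefree d) (hm : IsPlusAdm r d m) (hn : IsMinusAdm r d n)
    {p : ℕ} (hp : p ∈ n.primeFactors) : IsMinusIdx r (primeIdx (d * m * n) p) := by
  obtain ⟨h1, h2, h3⟩ := primeIdx_free_shape hr hd hm hn (mem_union_right _ hp)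
  exact ⟨h1, h2, h3 ▸ (hn.2.1 p hp).2.2⟩

/-- **Uniqueness of the factorisation (24.7), separation divisor**: if `d` is squarefree, `m`
satisfies `(d⁺)` and `n` satisfies `(d⁻)`, then `𝔡(d m n) = d`.
[cite: FriedlanderIwaniecAnnals1998, (24.7) ("unique factorization of this type")] -/
theorem sepDivisor_of_adm (hr : 2 ≤ r) (hd : Squarefree d) (hm : IsPlusAdm r d m) (hn : IsMinusAdm r d n) :
    sepDivisor r (d * m * n) = d := by
  have hset : (d * m * n).primeFactors.filter (fun q => IsSepIdx r (primeIdx (d * m * n) q)) = d.primeFactors := by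
    ext q
    rw [mem_filter, primeFactors_of_adm hd hm hn, mem_union, mem_union]
    constructor
    · rintro ⟨(hq | hq) | hq, hs⟩
      · exact hq
      · exact absurd (isPlusIdx_of_mem hr hd hm hn hq) (not_isPlusIdx_of_isSepIdx r hs)
      · exact absurd (isMinusIdx_of_mem hr hd hm hn hq) (not_isMinusIdx_of_isSepIdx r hs)
    · intro hq
      exact ⟨Or.inl (Or.inl hq), isSepIdx_of_mem (by omega) hd hm hn hq⟩
  rw [sepDivisor, hset, Nat.prod_primeFactors_of_squarefree hd]

/-- **Uniqueness of the factorisation (24.7), `m`**: `m(d m n) = m`.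
[cite: FriedlanderIwaniecAnnals1998, (24.7) ("unique factorization of this type")] -/
theorem plusPart_of_adm (hr : 2 ≤ r) (hd : Squarefree d) (hm : IsPlusAdm r d m) (hn : IsMinusAdm r d n) :
    plusPart r (d * m * n) = m := by
  have hset : (d * m * n).primeFactors.filter (fun q => IsPlusIdx r (primeIdx (d * m * n) q)) = m.primeFactors := by
    ext q
    rw [mem_filter, primeFactors_of_adm hd hm hn, mem_union, mem_union]
    constructor
    · rintro ⟨(hq | hq) | hq, hs⟩
      · exact absurd hs (not_isPlusIdx_of_isSepIdx r (isSepIdx_of_mem (by omega) hd hm hn hq))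
      · exact hq
      · exact absurd (isMinusIdx_of_mem hr hd hm hn hq) (not_isMinusIdx_of_isPlusIdx r hs)
    · intro hq
      exact ⟨Or.inl (Or.inr hq), isPlusIdx_of_mem hr hd hm hn hq⟩
  rw [plusPart, hset, Nat.prod_primeFactors_of_squarefree hm.1]

/-- **Uniqueness of the factorisation (24.7), `n`**: `n(d m n) = n`.
[cite: FriedlanderIwaniecAnnals1998, (24.7) ("unique factorization of this type")] -/
theorem minusPart_of_adm (hr : 2 ≤ r) (hd : Squarefree d) (hm : IsPlusAdm r d m) (hn : IsMinusAdm r d n) :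
    minusPart r (d * m * n) = n := by
  have hset : (d * m * n).primeFactors.filter (fun q => IsMinusIdx r (primeIdx (d * m * n) q)) = n.primeFactors := by
    ext q
    rw [mem_filter, primeFactors_of_adm hd hm hn, mem_union, mem_union]
    constructor
    · rintro ⟨(hq | hq) | hq, hs⟩
      · exact absurd hs (not_isMinusIdx_of_isSepIdx r (isSepIdx_of_mem (by omega) hd hm hn hq))
      · exact absurd hs (not_isMinusIdx_of_isPlusIdx r (isPlusIdx_of_mem hr hd hm hn hq))
      · exact hq
    · intro hq
      exact ⟨Or.inr hq, isMinusIdx_of_mem hr hd hm hn hq⟩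
  rw [minusPart, hset, Nat.prod_primeFactors_of_squarefree hn.1]

/-- `𝔡(ℓ)` is squarefree for squarefree `ℓ`. [cite: FriedlanderIwaniecAnnals1998, (24.7)] -/
theorem squarefree_sepDivisor {ℓ : ℕ} (hℓ : Squarefree ℓ) : Squarefree (sepDivisor r ℓ) :=
  hℓ.squarefree_of_dvd (sepDivisor_dvd hℓ)

/-- **The separation factorisation is a bijection** between squarefree `ℓ` and the triples
`(d, m, n)` with `d` squarefree, `m` satisfying `(d⁺)`, `n` satisfying `(d⁻)`; the inverse is
`(d, m, n) ↦ d m n`. [cite: FriedlanderIwaniecAnnals1998, (24.7) ("unique factorization of this type")] -/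
theorem sepTriple_eq_iff (hr : 2 ≤ r) {ℓ d m n : ℕ} (hℓ : Squarefree ℓ) :
    (sepDivisor r ℓ = d ∧ plusPart r ℓ = m ∧ minusPart r ℓ = n) ↔
      (Squarefree d ∧ IsPlusAdm r d m ∧ IsMinusAdm r d n ∧ d * m * n = ℓ) := by
  constructor
  · rintro ⟨rfl, rfl, rfl⟩
    exact ⟨squarefree_sepDivisor hℓ, isPlusAdm_plusPart hr hℓ, isMinusAdm_minusPart hr hℓ,
      sepDivisor_mul_plusPart_mul_minusPart r hℓ⟩
  · rintro ⟨hd, hm, hn, rfl⟩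
    exact ⟨sepDivisor_of_adm hr hd hm hn, plusPart_of_adm hr hd hm hn, minusPart_of_adm hr hd hm hn⟩

end Uniqueness

/-! ### Lemma 24.1: the sum over `ℓ` as a triple sum over `(𝔡, m, n)` -/

section Sums

variable {r : ℕ} {M : Type*} [AddCommMonoid M]

/-- **Lemma 24.1, combinatorial core**: for a finite set `S` of squarefree numbers and any finite
sets `Dset ⊇ 𝔡(S)`, `Mset ⊇ m(S)`, `Nset ⊇ n(S)`,
`Σ_{ℓ ∈ S} f(ℓ) = Σ_{d ∈ Dset} Σ_{m ∈ Mset} Σ_{n ∈ Nset} [m satisfies (d⁺), n satisfies (d⁻), dmn ∈ S] f(dmn)`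
(the factorisation `ℓ = 𝔡 m n` is a bijection onto the admissible triples).
[cite: FriedlanderIwaniecAnnals1998, Lemma 24.1] -/
theorem sum_eq_sum_sepTriple (hr : 2 ≤ r) (S Dset Mset Nset : Finset ℕ) (hS : ∀ ℓ ∈ S, Squarefree ℓ)
    (hD : ∀ ℓ ∈ S, sepDivisor r ℓ ∈ Dset) (hM : ∀ ℓ ∈ S, plusPart r ℓ ∈ Mset)
    (hN : ∀ ℓ ∈ S, minusPart r ℓ ∈ Nset) (f : ℕ → M) :
    ∑ ℓ ∈ S, f ℓ = ∑ d ∈ Dset, ∑ m ∈ Mset, ∑ n ∈ Nset,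
      if IsPlusAdm r d m ∧ IsMinusAdm r d n ∧ d * m * n ∈ S then f (d * m * n) else 0 := by
  classical
  -- the admissible triples
  set T := (Dset ×ˢ (Mset ×ˢ Nset)).filter fun t : ℕ × ℕ × ℕ =>
    IsPlusAdm r t.1 t.2.1 ∧ IsMinusAdm r t.1 t.2.2 ∧ t.1 * t.2.1 * t.2.2 ∈ S with hT
  have hRHS : (∑ d ∈ Dset, ∑ m ∈ Mset, ∑ n ∈ Nset,
      if IsPlusAdm r d m ∧ IsMinusAdm r d n ∧ d * m * n ∈ S then f (d * m * n) else 0) =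
      ∑ t ∈ T, f (t.1 * t.2.1 * t.2.2) := by
    rw [hT, sum_filter, sum_product]
    refine sum_congr rfl fun d _ => ?_
    rw [sum_product]
  rw [hRHS]
  refine sum_nbij' (fun ℓ => (sepDivisor r ℓ, plusPart r ℓ, minusPart r ℓ)) (fun t => t.1 * t.2.1 * t.2.2)
    ?_ ?_ ?_ ?_ ?_
  · intro ℓ hℓ
    have h := (sepTriple_eq_iff hr (hS ℓ hℓ)).mp ⟨rfl, rfl, rfl⟩
    refine mem_filter.mpr ⟨mem_product.mpr ⟨hD ℓ hℓ, mem_product.mpr ⟨hM ℓ hℓ, hN ℓ hℓ⟩⟩, h.2.1, h.2.2.1, ?_⟩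
    dsimp only; rw [h.2.2.2]; exact hℓ
  · intro t ht
    exact (mem_filter.mp ht).2.2.2
  · intro ℓ hℓ
    exact sepDivisor_mul_plusPart_mul_minusPart r (hS ℓ hℓ)
  · intro t ht
    obtain ⟨-, hm, hn, hmem⟩ := mem_filter.mp ht
    have hsq := hS _ hmem
    have hd : Squarefree t.1 := hsq.of_mul_left |>.of_mul_left
    have h := (sepTriple_eq_iff hr hsq (d := t.1) (m := t.2.1) (n := t.2.2)).mpr ⟨hd, hm, hn, rfl⟩
    ext <;> simp only [h.1, h.2.1, h.2.2]
  · intro ℓ hℓ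
    dsimp only; rw [sepDivisor_mul_plusPart_mul_minusPart r (hS ℓ hℓ)]

/-- `1 ≤ m(ℓ)`. [cite: FriedlanderIwaniecAnnals1998, (24.4)] -/
theorem one_le_plusPart (r ℓ : ℕ) : 1 ≤ plusPart r ℓ :=
  prod_pos fun _ hp => (Nat.prime_of_mem_primeFactors (mem_filter.mp hp).1).pos

/-- `1 ≤ n(ℓ)`. [cite: FriedlanderIwaniecAnnals1998, (24.5)] -/
theorem one_le_minusPart (r ℓ : ℕ) : 1 ≤ minusPart r ℓ :=
  prod_pos fun _ hp => (Nat.prime_of_mem_primeFactors (mem_filter.mp hp).1).pos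

/-- The squarefree `z`-smooth numbers `ℓ ≤ x` ("`ℓ ∣ P(z)`", (24.9): `P(z) = ∏_{p < z} p`), the range
of summation in Lemma 24.1. [cite: FriedlanderIwaniecAnnals1998, (24.9)] -/
def smoothSqf (x z : ℕ) : Finset ℕ :=
  (Icc 1 x).filter fun ℓ => Squarefree ℓ ∧ ∀ p ∈ ℓ.primeFactors, p < z

/-- Membership in `smoothSqf`. [cite: FriedlanderIwaniecAnnals1998, (24.9)] -/
theorem mem_smoothSqf {x z ℓ : ℕ} :
    ℓ ∈ smoothSqf x z ↔ (1 ≤ ℓ ∧ ℓ ≤ x) ∧ Squarefree ℓ ∧ ∀ p ∈ ℓ.primeFactors, p < z := by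
  rw [smoothSqf, mem_filter, mem_Icc]

/-- **(24.10)**: for `ℓ ≤ x` squarefree and `z`-smooth, `𝔡(ℓ) ≤ D` as soon as `z^{r(r-1)} x ≤ D^r`
(with `z = x^{1/r²}` this is `D = x^{2/r}`). [cite: FriedlanderIwaniecAnnals1998, (24.10)] -/
theorem sepDivisor_le_of_smooth {x z D ℓ : ℕ} (hr : 0 < r) (hz : 1 ≤ z) (hD : z ^ (r * (r - 1)) * x ≤ D ^ r)
    (hℓ : ℓ ∈ smoothSqf x z) : sepDivisor r ℓ ≤ D := by
  rw [mem_smoothSqf] at hℓ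
  have h := sepDivisor_pow_le (r := r) hℓ.2.1 hz fun p hp => (hℓ.2.2 p hp).le
  have : sepDivisor r ℓ ^ r ≤ D ^ r :=
    h.trans ((Nat.mul_le_mul_left _ hℓ.1.2).trans hD)
  exact (Nat.pow_le_pow_iff_left hr.ne').mp this

/-- **Lemma 24.1** (Friedlander–Iwaniec): for `r ≥ 2`, `z ≥ 1` and `D` with `z^{r(r-1)} x ≤ D^r`
((24.10): `z = x^{1/r²}`, `D = x^{2/r}`), and any `f`,
`Σ_{ℓ ≤ x, ℓ ∣ P(z)} f(ℓ) = Σ_{𝔡 ≤ D} Σ_{m, n ≤ √x} γ⁺_𝔡(m) γ⁻_𝔡(n) f(𝔡 m n)`, where `γ⁺_𝔡`, `γ⁻_𝔡` are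
the indicators of `(𝔡⁺)`, `(𝔡⁻)` and the summand is restricted to `𝔡 m n ≤ x`, `𝔡 m n ∣ P(z)`
squarefree (in the source this restriction is carried by the support of `f`; the printed right side
of (24.11) needs `𝔡 ∣ P(z)` as well, which is part of it here). [cite: FriedlanderIwaniecAnnals1998, Lemma 24.1] -/
theorem sum_smoothSqf_eq (hr : 2 ≤ r) {x z D : ℕ} (hz : 1 ≤ z) (hD : z ^ (r * (r - 1)) * x ≤ D ^ r)
    (f : ℕ → M) :
    ∑ ℓ ∈ smoothSqf x z, f ℓ = ∑ d ∈ Icc 1 D, ∑ m ∈ Icc 1 (Nat.sqrt x), ∑ n ∈ Icc 1 (Nat.sqrt x),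
      if IsPlusAdm r d m ∧ IsMinusAdm r d n ∧ d * m * n ∈ smoothSqf x z then f (d * m * n) else 0 := by
  refine sum_eq_sum_sepTriple hr _ _ _ _ (fun ℓ hℓ => (mem_smoothSqf.mp hℓ).2.1) ?_ ?_ ?_ f
  · intro ℓ hℓ
    exact mem_Icc.mpr ⟨one_le_sepDivisor r ℓ, sepDivisor_le_of_smooth (by omega) hz hD hℓ⟩
  · intro ℓ hℓ
    have h := mem_smoothSqf.mp hℓ
    refine mem_Icc.mpr ⟨one_le_plusPart r ℓ, Nat.le_sqrt.mpr ?_⟩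
    have := plusPart_sq_le r hr h.2.1
    rw [sq] at this; exact this.trans h.1.2
  · intro ℓ hℓ
    have h := mem_smoothSqf.mp hℓ
    refine mem_Icc.mpr ⟨one_le_minusPart r ℓ, Nat.le_sqrt.mpr ?_⟩
    have := minusPart_sq_le r hr h.2.1
    rw [sq] at this; exact this.trans h.1.2

/-! ### (24.12) and Proposition 24.2 -/

/-- The squarefree numbers `1 ≤ ℓ ≤ x` (the support of `f` in Lemma 24.1 / Proposition 24.2).
[cite: FriedlanderIwaniecAnnals1998, Lemma 24.1] -/
def sqfLE (x : ℕ) : Finset ℕ := (Icc 1 x).filter Squarefree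

/-- Membership in `sqfLE`. [cite: FriedlanderIwaniecAnnals1998, Lemma 24.1] -/
theorem mem_sqfLE {x ℓ : ℕ} : ℓ ∈ sqfLE x ↔ (1 ≤ ℓ ∧ ℓ ≤ x) ∧ Squarefree ℓ := by
  rw [sqfLE, mem_filter, mem_Icc]

/-- `ν(ℓ, z)`: the number of prime factors `p ≥ z` of `ℓ` ((24.12): "the number of prime factors
`p > z` of `ℓ`"; with `P(z) = ∏_{p<z} p` the complementary primes are `p ≥ z`).
[cite: FriedlanderIwaniecAnnals1998, (24.12)] -/
def roughCount (z ℓ : ℕ) : ℕ := #(ℓ.primeFactors.filter (z ≤ ·))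

/-- Unfolding `roughCount`. [cite: FriedlanderIwaniecAnnals1998, (24.12)] -/
theorem roughCount_def (z ℓ : ℕ) : roughCount z ℓ = #(ℓ.primeFactors.filter (z ≤ ·)) := rfl

/-- `ν(ℓ, z) = 0` iff `ℓ` is `z`-smooth. [cite: FriedlanderIwaniecAnnals1998, (24.12)] -/
theorem roughCount_eq_zero_iff {z ℓ : ℕ} : roughCount z ℓ = 0 ↔ ∀ p ∈ ℓ.primeFactors, p < z := by
  rw [roughCount, card_eq_zero, filter_eq_empty_iff]
  simp only [not_le]

/-- `ν(q, z) = 0` for `q < z`. [cite: FriedlanderIwaniecAnnals1998, (24.13)] -/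
theorem roughCount_eq_zero_of_lt {z q : ℕ} (hq : q < z) : roughCount z q = 0 :=
  roughCount_eq_zero_iff.mpr fun _ hp => (Nat.le_of_mem_primeFactors hp).trans_lt hq

/-- `ν(pq, z) = 1 + ν(q, z)` for a prime `p ≥ z` with `pq` squarefree.
[cite: FriedlanderIwaniecAnnals1998, (24.13)] -/
theorem roughCount_prime_mul {z p q : ℕ} (hp : p.Prime) (hzp : z ≤ p) (hsq : Squarefree (p * q)) :
    roughCount z (p * q) = 1 + roughCount z q := by
  have hq0 : q ≠ 0 := fun h => by rw [h, mul_zero] at hsq; exact not_squarefree_zero hsq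
  have hpq : ¬ p ∣ q := fun h => by
    have : p * p ∣ p * q := Nat.mul_dvd_mul_left p h
    exact hp.ne_one (Nat.isUnit_iff.mp (hsq p this))
  rw [roughCount, Nat.primeFactors_mul hp.ne_zero hq0, hp.primeFactors, filter_union,
    card_union_of_disjoint, roughCount]
  · rw [filter_singleton, if_pos hzp, card_singleton]
  · rw [filter_singleton, if_pos hzp, disjoint_singleton_left, mem_filter, Nat.mem_primeFactors]
    exact fun h => hpq h.1.2.1

/-- The primes `z ≤ p ≤ x`. [cite: FriedlanderIwaniecAnnals1998, (24.12)] -/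
def primesIcc (z x : ℕ) : Finset ℕ := (Icc z x).filter Nat.Prime

variable {K : Type*} [DivisionRing K] [CharZero K]

/-- **(24.12)**: `Σ_{ℓ ≤ x sqf} f(ℓ) = Σ_{ℓ ∣ P(z)} f(ℓ) + Σ_{p ≥ z} Σ_q f(pq) ν(pq, z)⁻¹` (every
non-smooth squarefree `ℓ` is `pq` for exactly `ν(ℓ, z)` primes `p ≥ z`).
[cite: FriedlanderIwaniecAnnals1998, (24.12)] -/
theorem sum_sqfLE_eq (x z : ℕ) (f : ℕ → K) :
    ∑ ℓ ∈ sqfLE x, f ℓ = ∑ ℓ ∈ smoothSqf x z, f ℓ +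
      ∑ p ∈ primesIcc z x, ∑ q ∈ Icc 1 x,
        if p * q ∈ sqfLE x then ((roughCount z (p * q) : ℕ) : K)⁻¹ * f (p * q) else 0 := by
  classical
  -- smooth + rough
  have hsplit : ∑ ℓ ∈ sqfLE x, f ℓ = ∑ ℓ ∈ smoothSqf x z, f ℓ +
      ∑ ℓ ∈ (sqfLE x).filter (fun ℓ => roughCount z ℓ ≠ 0), f ℓ := by
    have h1 : smoothSqf x z = (sqfLE x).filter fun ℓ => roughCount z ℓ = 0 := by
      ext ℓ; simp only [mem_smoothSqf, mem_filter, mem_sqfLE, roughCount_eq_zero_iff, and_assoc]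
    rw [h1, ← sum_filter_add_sum_filter_not (sqfLE x) (fun ℓ => roughCount z ℓ = 0)]
  rw [hsplit]
  congr 1
  -- the pairs `(p, q)` with `pq ≤ x` squarefree, `p ≥ z` prime
  set W := (primesIcc z x ×ˢ Icc 1 x).filter (fun pq : ℕ × ℕ => pq.1 * pq.2 ∈ sqfLE x) with hW
  have hRHS : (∑ p ∈ primesIcc z x, ∑ q ∈ Icc 1 x,
      if p * q ∈ sqfLE x then ((roughCount z (p * q) : ℕ) : K)⁻¹ * f (p * q) else 0) =
      ∑ pq ∈ W, ((roughCount z (pq.1 * pq.2) : ℕ) : K)⁻¹ * f (pq.1 * pq.2) := by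
    rw [hW, sum_filter, sum_product]
  rw [hRHS]
  -- group the pairs by `ℓ = pq`
  have hmaps : ∀ pq ∈ W, pq.1 * pq.2 ∈ sqfLE x := fun pq h => (mem_filter.mp h).2
  rw [← sum_fiberwise_of_maps_to hmaps]
  -- compare fibrewise
  rw [sum_filter]
  refine sum_congr rfl fun ℓ hℓ => ?_
  have hfib : ∑ pq ∈ W with pq.1 * pq.2 = ℓ, ((roughCount z (pq.1 * pq.2) : ℕ) : K)⁻¹ * f (pq.1 * pq.2) =
      (#(W.filter fun pq => pq.1 * pq.2 = ℓ) : K) * (((roughCount z ℓ : ℕ) : K)⁻¹ * f ℓ) := by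
    rw [← nsmul_eq_mul, ← sum_const]
    refine sum_congr rfl fun pq hpq => ?_
    rw [(mem_filter.mp hpq).2]
  rw [hfib]
  -- the fibre over `ℓ` has `ν(ℓ, z)` elements
  have hsq := (mem_sqfLE.mp hℓ)
  have hcard : #(W.filter fun pq => pq.1 * pq.2 = ℓ) = roughCount z ℓ := by
    rw [roughCount]
    refine card_nbij' (fun pq => pq.1) (fun p => (p, ℓ / p)) ?_ ?_ ?_ ?_
    · intro pq hpq
      rw [mem_coe, mem_filter] at hpq
      obtain ⟨hW', hprod⟩ := hpq
      rw [hW, mem_filter, mem_product, primesIcc, mem_filter, mem_Icc] at hW'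
      rw [mem_coe]
      exact mem_filter.mpr ⟨Nat.mem_primeFactors.mpr ⟨hW'.1.1.2, ⟨pq.2, hprod.symm⟩, hsq.2.ne_zero⟩, hW'.1.1.1.1⟩
    · intro p hp
      rw [mem_coe, mem_filter, Nat.mem_primeFactors] at hp
      obtain ⟨⟨hp, hpl, hl0⟩, hzp⟩ := hp
      have hpl' : p * (ℓ / p) = ℓ := Nat.mul_div_cancel' hpl
      rw [mem_coe]
      refine mem_filter.mpr ⟨?_, hpl'⟩
      rw [hW, mem_filter, mem_product, primesIcc, mem_filter, mem_Icc, mem_Icc]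
      refine ⟨⟨⟨⟨hzp, (Nat.le_of_dvd (by omega) hpl).trans hsq.1.2⟩, hp⟩, ?_, ?_⟩, by rw [hpl']; exact hℓ⟩
      · exact Nat.div_pos (Nat.le_of_dvd (by omega) hpl) hp.pos
      · exact (Nat.div_le_self ℓ p).trans hsq.1.2
    · intro pq hpq
      rw [mem_coe, mem_filter] at hpq
      obtain ⟨hW', hprod⟩ := hpq
      rw [hW, mem_filter, mem_product, primesIcc, mem_filter] at hW'
      have hp0 : 0 < pq.1 := hW'.1.1.2.pos
      ext
      · rfl
      · show ℓ / pq.1 = pq.2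
        rw [← hprod, Nat.mul_div_cancel_left _ hp0]
    · intro p _; rfl
  rw [hcard]
  by_cases h0 : roughCount z ℓ = 0
  · rw [if_neg (by rw [h0]; exact fun h => h rfl), h0, Nat.cast_zero, zero_mul]
  · rw [if_pos h0, ← mul_assoc, mul_inv_cancel₀ (Nat.cast_ne_zero.mpr h0), one_mul]

/-- **Proposition 24.2** (Friedlander–Iwaniec): for `r ≥ 2`, `z ≥ 1`, `D` with `z^{r(r-1)} x ≤ D^r`
and any `f` on the squarefree `ℓ ≤ x`,
`Σ_ℓ f(ℓ) = Σ_{𝔡 ≤ D} ΣΣ_{m,n ≤ √x} γ⁺_𝔡(m) γ⁻_𝔡(n) f(𝔡mn) + ΣΣ_{p, q ≥ z} γ(q) f(pq) + ΣΣ_{p ≥ z > q} f(pq)`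
with `γ(q) = (1 + ν(q, z))⁻¹`, `p` prime (the first sum restricted to `𝔡 m n ∣ P(z)`, the last two to
`pq ≤ x` squarefree). [cite: FriedlanderIwaniecAnnals1998, Proposition 24.2] -/
theorem sum_sqfLE_eq_sepTriple_add (hr : 2 ≤ r) {x z D : ℕ} (hz : 1 ≤ z)
    (hD : z ^ (r * (r - 1)) * x ≤ D ^ r) (f : ℕ → K) :
    ∑ ℓ ∈ sqfLE x, f ℓ =
      (∑ d ∈ Icc 1 D, ∑ m ∈ Icc 1 (Nat.sqrt x), ∑ n ∈ Icc 1 (Nat.sqrt x),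
        if IsPlusAdm r d m ∧ IsMinusAdm r d n ∧ d * m * n ∈ smoothSqf x z then f (d * m * n) else 0) +
      (∑ p ∈ primesIcc z x, ∑ q ∈ (Icc 1 x).filter (z ≤ ·),
        if p * q ∈ sqfLE x then ((1 + roughCount z q : ℕ) : K)⁻¹ * f (p * q) else 0) +
      ∑ p ∈ primesIcc z x, ∑ q ∈ (Icc 1 x).filter (· < z), if p * q ∈ sqfLE x then f (p * q) else 0 := by
  rw [sum_sqfLE_eq x z f, sum_smoothSqf_eq hr hz hD f, add_assoc]
  congr 1
  rw [← sum_add_distrib]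
  refine sum_congr rfl fun p hp => ?_
  rw [primesIcc, mem_filter, mem_Icc] at hp
  rw [← sum_filter_add_sum_filter_not (Icc 1 x) (z ≤ ·)]
  congr 1
  · refine sum_congr rfl fun q hq => ?_
    split_ifs with h
    · rw [roughCount_prime_mul hp.2 hp.1.1 (mem_sqfLE.mp h).2]
    · rfl
  · have : (Icc 1 x).filter (fun q => ¬ z ≤ q) = (Icc 1 x).filter (· < z) :=
      filter_congr fun q _ => not_le
    rw [this]
    refine sum_congr rfl fun q hq => ?_
    rw [mem_filter] at hq
    split_ifs with h
    · rw [roughCount_prime_mul hp.2 hp.1.1 (mem_sqfLE.mp h).2, roughCount_eq_zero_of_lt hq.2]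
      simp
    · rfl

end Sums

end Literature.NumberTheory.Sieve.FriedlanderIwaniecPrimes
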